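/-
Copyright: the b2b-balaban T⁴-continuum CRUX team, row NE7b OWNER lineage `t4-ne7b-p1` (gen 107). Project licence.
-/
import Summits.QuantumFields.BalabanUV.T4Continuum.Spine.NE7b.TiltedMeanShift
import Summits.QuantumFields.BalabanUV.T4Continuum.Spine.NE7b.ConvexWindowTiltMoment

/-!
# THE TILTED-MEAN SHIFT ON A CONVEX WINDOW: `|𝔼_{K,W+P}⟪u,x⟫ − 𝔼_{K,W}⟪u,x⟫| ≤ λ⁻¹((a∕2)‖u‖² + 𝔼_{K,W}‖∇e^{−P}‖²∕(2a)) ∕ 𝔼_{K,W}e^{−P}`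
# for the WINDOWED tilt `ν_{W,K} = 1_K e^{−W}dx ∕ ∫_K e^{−W}`, `K` CONVEX, `W` `λ`-uniformly convex ON `K` ONLY
# (row NE7b, node U5c; the (R1″)-class tilted-mean letter of the windowed convexity road; T-60e on the window)

Cell `pub-balaban`, sub-cell `t4`, spine estimate NE7b (`T4WeightBudget.RelWeightBound`; the cell's OWN estimate — NOT PRINTED in
[Bałaban 1983–89], NOT PROVED).  Crux-route work under `Spine/NE7b/` by the row's OWNER; NOTHING of Bałaban's is named or asserted;
no `T4Continuum/Support` leaf typed; no `def`; zero `sorry`.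

WHY.  The windowed convexity road (`…NE7b.ConvexWindowTiltMoment.exp_moment_le_of_uniformlyConvex_on_convexWindow`, this gen)
displays the WINDOWED tilted means `m_k = ∫⟪u_k,x⟫ dν_{V,K}` of the full exponent `V = W₀ + P`; in the centred even class on a
symmetric window they vanish (`…_on_symmConvexWindow_even`), otherwise the owner's derivative-free shift bound
(`…NE7b.TiltedMeanShift.abs_tiltedMean_shift_le`, T-60e) controls how far the anharmonic part `P` moves them from the means of `W₀` —
but that file asks `W₀` convex on the WHOLE carrier (it uses the tree's unwindowed Brascamp–Lieb).  THIS FILE re-runs T-60e ON THE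
WINDOW: the covariance identity, AM–GM and Jensen are the measure-generic §1 of `TiltedMeanShift` (any probability measure — here the
windowed tilt), and Brascamp–Lieb is the WINDOWED inequality `…ConvexWindowBrascampLieb.variance_windowTilted_le`, used twice (at
`⟪u,·⟫` and at `e^{−P}`), so that convexity of `W₀` is asked between points of `K` only.

WHAT IS PROVED ([folklore]): `windowTilted_tilted` (the re-weighted windowed tilt IS the windowed tilt of `W + P`: Mathlib's
`tilted_tilted`), `variance_inner_le_on_convexWindow`, `variance_exp_neg_le_on_convexWindow`, and
**`abs_windowTiltedMean_shift_le`**: for `K` convex measurable of positive volume, `W` continuous and `λ`-uniformly convex ON `K`,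
`e^{−W}` integrable on `K`, `P ∈ C¹` and `u` with the displayed integrabilities under `ν = ν_{W,K}`, any `a > 0`:
`|∫⟪u,x⟫ d(ν.tilted(−P)) − ∫⟪u,x⟫ dν| ≤ λ⁻¹·((a∕2)‖u‖² + (∫‖∇e^{−P}‖² dν)∕(2a)) ∕ ∫e^{−P} dν` (and `∫e^{−P}dν ≥ e^{−∫P dν}` is
`TiltedMeanShift.integral_exp_neg_ge_exp_neg_integral`).

NOT HERE (honest): the size of `∇P`, `𝔼P` for Bałaban's anharmonic remainders on their windows ((A1c) readings); the intensive
(decay) letter and the interpolation form (leaf-01 g80 `TiltedMeanShiftInterpolated` ∕ `…Endpoints` on the unwindowed tilt); anything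
of Bałaban's.  NE7b NOT PRINTED ∕ NOT PROVED; spine PROVED 0∕9; rung (B)+1 on a FINITE torus — NOT infinite volume, NOT the mass gap,
NOT Clay.
HONEST DEPENDENCY: continuum YM on T⁴ ⇐ BetaPertH ∧ nine spine estimates (0/9 proved); BetaPertH ⇐ (D1) ∧ (D4) ∧ CAP+tail.
-/

set_option autoImplicit false

noncomputable section

open MeasureTheory Real Finset
open scoped RealInnerProductSpace
open Summit.QuantumFields.BalabanUV.T4Continuum.NE7b.TiltedMeanShift
open Summit.QuantumFields.BalabanUV.T4Continuum.NE7b.ConvexWindowBrascampLieb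
open Summit.QuantumFields.BalabanUV.T4Continuum.NE7b.ConvexWindowTiltMoment

namespace Summit.QuantumFields.BalabanUV.T4Continuum.NE7b.ConvexWindowTiltedMeanShift

variable {n : ℕ}

/-- Re-weighting the windowed tilt of `W` by `e^{−P}` gives the windowed tilt of `W + P`:
`(ν_{W,K}).tilted(−P) = ν_{W+P,K}` (Mathlib's `tilted_tilted`; `e^{−W}` integrable on `K`). [folklore] -/
theorem windowTilted_tilted {W P : EuclideanSpace ℝ (Fin n) → ℝ} {K : Set (EuclideanSpace ℝ (Fin n))}
    (hZ : IntegrableOn (fun x => exp (-W x)) K) :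
    ((volume.restrict K).tilted fun x => -W x).tilted (fun x => -P x) =
      (volume.restrict K).tilted fun x => -(W x + P x) := by
  rw [tilted_tilted hZ]
  congr 1
  funext x
  simp only [Pi.add_apply]
  ring

/-- **WINDOWED BL AT A LINEAR TEST FUNCTION** (variance form): `∫⟪u,x⟫² dν − (∫⟪u,x⟫dν)² ≤ λ⁻¹‖u‖²` under the windowed
`λ`-uniformly log-concave tilt `ν = ν_{W,K}`, `K` convex. [folklore] -/
theorem variance_inner_le_on_convexWindow {W : EuclideanSpace ℝ (Fin n) → ℝ} {lam : ℝ}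
    {K : Set (EuclideanSpace ℝ (Fin n))} (hlam : 0 < lam) (hK : Convex ℝ K) (hKm : MeasurableSet K)
    (hK0 : volume K ≠ 0) (hWc : Continuous W)
    (hW : ∀ x ∈ K, ∀ y ∈ K, W x + ⟪gradient W x, y - x⟫ + lam / 2 * ‖y - x‖ ^ 2 ≤ W y)
    (hZ : IntegrableOn (fun x => exp (-W x)) K) (u : EuclideanSpace ℝ (Fin n))
    (h1 : Integrable (fun x => ⟪u, x⟫) ((volume.restrict K).tilted fun x => -W x))
    (h2 : Integrable (fun x => ⟪u, x⟫ ^ 2) ((volume.restrict K).tilted fun x => -W x)) :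
    ∫ x, ⟪u, x⟫ ^ 2 ∂((volume.restrict K).tilted fun x => -W x) -
        (∫ x, ⟪u, x⟫ ∂((volume.restrict K).tilted fun x => -W x)) ^ 2 ≤ lam⁻¹ * ‖u‖ ^ 2 := by
  have := sq_moment_inner_le_on_convexWindow hlam hK hKm hK0 hWc hW hZ u h1 h2
  linarith

/-- **WINDOWED BL AT `e^{−P}`**: `Var_ν(e^{−P}) ≤ λ⁻¹·∫‖∇e^{−P}‖² dν` for `ν = ν_{W,K}`, `P ∈ C¹`, displayed integrabilities.
[folklore] -/
theorem variance_exp_neg_le_on_convexWindow {W P : EuclideanSpace ℝ (Fin n) → ℝ} {lam : ℝ}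
    {K : Set (EuclideanSpace ℝ (Fin n))} (hlam : 0 < lam) (hK : Convex ℝ K) (hKm : MeasurableSet K)
    (hK0 : volume K ≠ 0) (hWc : Continuous W)
    (hW : ∀ x ∈ K, ∀ y ∈ K, W x + ⟪gradient W x, y - x⟫ + lam / 2 * ‖y - x‖ ^ 2 ≤ W y)
    (hZ : IntegrableOn (fun x => exp (-W x)) K) (hP : ContDiff ℝ 1 P)
    (g1 : Integrable (fun x => exp (-P x)) ((volume.restrict K).tilted fun x => -W x))
    (g2 : Integrable (fun x => exp (-P x) ^ 2) ((volume.restrict K).tilted fun x => -W x))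
    (g3 : Integrable (fun x => ‖fderiv ℝ (fun y => exp (-P y)) x‖ ^ 2) ((volume.restrict K).tilted fun x => -W x)) :
    ∫ x, exp (-P x) ^ 2 ∂((volume.restrict K).tilted fun x => -W x) -
        (∫ x, exp (-P x) ∂((volume.restrict K).tilted fun x => -W x)) ^ 2 ≤
      lam⁻¹ * ∫ x, ‖fderiv ℝ (fun y => exp (-P y)) x‖ ^ 2 ∂((volume.restrict K).tilted fun x => -W x) :=
  variance_windowTilted_le hlam hK hKm hK0 hWc hW hZ (hP.neg.exp) g1 g2 g3

/-- **THE SHIFT OF THE WINDOWED TILTED MEAN BY A PERTURBATION, DERIVATIVE-FREE (T-60e on a convex window).**  `K` convex measurable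
of positive volume; `W` continuous, `λ`-uniformly convex ON `K` (first-order letter between points of `K`), `e^{−W}` integrable on
`K`, `ν = ν_{W,K} = 1_K e^{−W}dx ∕ ∫_K e^{−W}`; `P ∈ C¹` with `e^{−P}`, `e^{−2P}`-type and gradient integrabilities under `ν`; `u` with
first ∕ second moments under `ν`; `a > 0` free.  Then, with `ν.tilted(−P) = ν_{W+P,K}` (`windowTilted_tilted`):
`|∫⟪u,x⟫ d(ν.tilted(−P)) − ∫⟪u,x⟫ dν| ≤ λ⁻¹·((a∕2)‖u‖² + (∫‖∇e^{−P}‖² dν)∕(2a)) ∕ ∫e^{−P} dν`. [folklore] -/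
theorem abs_windowTiltedMean_shift_le {W P : EuclideanSpace ℝ (Fin n) → ℝ} {lam a : ℝ}
    {K : Set (EuclideanSpace ℝ (Fin n))} (hlam : 0 < lam) (ha : 0 < a) (hK : Convex ℝ K) (hKm : MeasurableSet K)
    (hK0 : volume K ≠ 0) (hWc : Continuous W)
    (hW : ∀ x ∈ K, ∀ y ∈ K, W x + ⟪gradient W x, y - x⟫ + lam / 2 * ‖y - x‖ ^ 2 ≤ W y)
    (hZ : IntegrableOn (fun x => exp (-W x)) K) (hP : ContDiff ℝ 1 P) (u : EuclideanSpace ℝ (Fin n))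
    (h1 : Integrable (fun x => ⟪u, x⟫) ((volume.restrict K).tilted fun x => -W x))
    (h2 : Integrable (fun x => ⟪u, x⟫ ^ 2) ((volume.restrict K).tilted fun x => -W x))
    (g1 : Integrable (fun x => exp (-P x)) ((volume.restrict K).tilted fun x => -W x))
    (g2 : Integrable (fun x => exp (-P x) ^ 2) ((volume.restrict K).tilted fun x => -W x))
    (g3 : Integrable (fun x => ‖fderiv ℝ (fun y => exp (-P y)) x‖ ^ 2) ((volume.restrict K).tilted fun x => -W x))
    (hfg : Integrable (fun x => ⟪u, x⟫ * exp (-P x)) ((volume.restrict K).tilted fun x => -W x)) :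
    |∫ x, ⟪u, x⟫ ∂(((volume.restrict K).tilted fun x => -W x).tilted fun x => -P x) -
        ∫ x, ⟪u, x⟫ ∂((volume.restrict K).tilted fun x => -W x)| ≤
      lam⁻¹ * (a / 2 * ‖u‖ ^ 2 +
          (∫ x, ‖fderiv ℝ (fun y => exp (-P y)) x‖ ^ 2 ∂((volume.restrict K).tilted fun x => -W x)) / (2 * a)) /
        ∫ x, exp (-P x) ∂((volume.restrict K).tilted fun x => -W x) := by
  haveI : NeZero (volume.restrict K : Measure (EuclideanSpace ℝ (Fin n))) :=
    ⟨fun h => hK0 (Measure.restrict_eq_zero.1 h)⟩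
  haveI : IsProbabilityMeasure ((volume.restrict K).tilted fun x : EuclideanSpace ℝ (Fin n) => -W x) :=
    isProbabilityMeasure_tilted hZ
  have hZP : 0 < ∫ x, exp (-P x) ∂((volume.restrict K).tilted fun x => -W x) := integral_exp_pos g1
  rw [tiltedMean_sub_eq_cov_div _ g1, abs_div, abs_of_pos hZP]
  refine div_le_div_of_nonneg_right ?_ hZP.le
  refine (abs_cov_le_amgm _ ha h1 g1 h2 g2 hfg).trans ?_
  have hv1 := variance_inner_le_on_convexWindow hlam hK hKm hK0 hWc hW hZ u h1 h2
  have hv2 := variance_exp_neg_le_on_convexWindow hlam hK hKm hK0 hWc hW hZ hP g1 g2 g3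
  have hI : 0 ≤ ∫ x, ‖fderiv ℝ (fun y => exp (-P y)) x‖ ^ 2 ∂((volume.restrict K).tilted fun x => -W x) :=
    integral_nonneg fun x => sq_nonneg _
  have e : lam⁻¹ * (a / 2 * ‖u‖ ^ 2 +
      (∫ x, ‖fderiv ℝ (fun y => exp (-P y)) x‖ ^ 2 ∂((volume.restrict K).tilted fun x => -W x)) / (2 * a)) =
      a / 2 * (lam⁻¹ * ‖u‖ ^ 2) +
        (lam⁻¹ * ∫ x, ‖fderiv ℝ (fun y => exp (-P y)) x‖ ^ 2 ∂((volume.restrict K).tilted fun x => -W x)) / (2 * a) := by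
    ring
  rw [e]
  gcongr

end Summit.QuantumFields.BalabanUV.T4Continuum.NE7b.ConvexWindowTiltedMeanShift

end
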